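import Literature.AlgebraicGeometry.HodgeTheory.ComplexTorusRebaseToIntegralFrame     -- ★ p725630 (B-p09): re-basing to an integral frame
import Literature.AlgebraicGeometry.HodgeTheory.AbelianVarietyHodgeFullnessHolds       -- ★ `complexAbelianVariety_torusUniformised_holds`
import Literature.AlgebraicGeometry.HodgeTheory.AbelianVarietyIntegralCohomology      -- ★ `AbelianVariety.card_eq_two_mul_dim`
import Literature.Geometry.Kaehler.ComplexTorusSiegelNormalForm                          -- ★ `ComplexTorus.exists_homeomorph_of_baseChange`
import HarnessLib

/-!
# Uniformisation of a complex abelian variety of dimension `g` re-based to a prescribed integral frame of `H¹` indexed by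
# `Fin g ⊕ Fin g`, with model `ℂ^g` (U-e P4b leaf (B1a-unif))

Topic `AlgebraicGeometry/HodgeTheory`; namespace `Literature.AlgebraicGeometry.HodgeTheory`.  THEOREMS ONLY (no definition, no named
fact, no instance, no `sorry`).  Cell hodgecm-mathlib (D-0151), (U)-HEAD node U-e, socket P4, step (B1a) of the P4 lead's plan v0.6
(`B-provers/B-p03/PLAN-Ue-P4-v0.6.B-p03g13.md` §1.3: «uniformisations `(Φ x, φ x)` of `A_x` re-based to `γ x`»); hand B-p03 (g13).
HC_CM is proved only modulo the 7 printed citations until rung 0 closes; books 0.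

[Lange2023AbelianVarietiesComplex] §1.1 and [LangeBirkenhake1992] §8.1: an abelian variety `A` of dimension `g` is `V/Λ`; a `ℤ`-basis of `Λ` — equivalently (Lemma 1.1.17 (a):
`H¹(A, ℤ) = Hom(Λ, ℤ)`) a `ℤ`-basis of `H¹(A(ℂ); ℤ)/tors` — indexed by `λ₁ … λ_g, μ₁ … μ_g` presents `A(ℂ)` as `ℂ^g/Π ℤ^{2g}`.  In the tree's
currency: ★ `complexAbelianVariety_torusUniformised_holds` gives SOME uniformisation `E/Φ₀(ℤ^ι) → A(ℂ)` (arbitrary finite `ι`,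
`|ι| = 2 dim A`, model `ℂ^{dim A}`); ★ `exists_rebase_of_basis_integralLattice_of_add` (B-p09, p725630) re-bases it to any `ℤ`-basis of the
integral lattice `integralLattice A.X 1` indexed by `ι`; ★ `ComplexTorus.exists_homeomorph_of_baseChange` re-indexes the torus along a
bijection `ι ≃ Fin g ⊕ Fin g` (a permutation matrix is a unimodular base change with analytic representation `1`), and ★
`map_latticeClass_of_mapMatrix` tracks the canonical lattice classes.

* `AbelianVariety.exists_uniformisation_of_basis_integralLattice` — for `A` with `A.dim = g` and any `ℤ`-basis `c` of
  `H¹(A(ℂ); ℤ)/tors ⊂ H¹(A(ℂ); ℚ)` indexed by `Fin g ⊕ Fin g`: a uniformisation `φ : ℝ^{Fin g ⊕ Fin g}/ℤ^{…} → A(ℂ)` (chart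
  `Φ : ℝ^{Fin g ⊕ Fin g} ≃ ℂ^g`, analytification, additive) whose canonical lattice classes ARE the `c a`:
  `φ^* (c a) = latticeClass Φ a` — the input shape of ★ (L5) `exists_siegelAdelicMarking_of_hodgeFrame` and of ★ (F10)/(B4).

## References
* [Lange2023AbelianVarietiesComplex] H. Lange, *Abelian Varieties over the Complex Numbers* (2023), §1.1.1–§1.1.3 (Lemma 1.1.2,
  §1.1.2 `ρ_r`, Lemma 1.1.17 (a)) (pp. 6–14).
* [LangeBirkenhake1992] H. Lange, Ch. Birkenhake, *Complex Abelian Varieties* (1992), Ch. 8 §8.1.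
* [Shimura1998] G. Shimura, *Abelian Varieties with Complex Multiplication and Modular Functions* (1998), §3.1 (uniformisation `θ : A ≅ ℂⁿ/D`).
-/

set_option autoImplicit false

noncomputable section

open CategoryTheory AlgebraicGeometry Matrix
open scoped Manifold ContDiff
open Literature.AlgebraicTopology.SingularHomology
open Literature.Geometry.Kaehler Literature.Geometry.Kaehler.ComplexTorus
open Literature.NumberTheory.Transcendental
open Literature.AlgebraicGeometry.Motives (ComplexPoints AbelianVariety)

namespace Literature.AlgebraicGeometry.HodgeTheory

namespace AbelianVariety

/-- **A UNIFORMISATION RE-BASED TO A PRESCRIBED INTEGRAL FRAME, indexed by `Fin g ⊕ Fin g`, model `ℂ^g`.**  For a complex abelian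
variety `A` of dimension `g` and a `ℤ`-basis `c` of the integral lattice `H¹(A(ℂ); ℤ)/tors ⊂ H¹(A(ℂ); ℚ)` indexed by `Fin g ⊕ Fin g`,
there is a uniformisation `φ : ℝ^{2g}/ℤ^{2g} → A(ℂ)` — complex chart `Φ : ℝ^{Fin g ⊕ Fin g} ≃ ℂ^g`, `φ` the analytification of `A`, a group
homomorphism — whose canonical lattice classes are the given frame: `φ^* (c a) = ξ_a` (★ `latticeClass Φ a`) for every `a`.
(Uniformise ★, re-base to `c` reindexed along a bijection `ι ≃ Fin g ⊕ Fin g` ★, re-index the torus by the permutation matrix ★.)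
[cite: Lange2023AbelianVarietiesComplex, §1.1.1–§1.1.3 (Lemma 1.1.2, §1.1.2, Lemma 1.1.17 (a)) (pp. 6–14)] [cite: LangeBirkenhake1992, Ch. 8 §8.1]
[cite: Shimura1998, §3.1] -/
theorem exists_uniformisation_of_basis_integralLattice (A : AbelianVariety ℂ) {g : ℕ} (hg : A.dim = g)
    (c : Module.Basis (Fin g ⊕ Fin g) ℤ (integralLattice A.X 1)) :
    ∃ (Φ : (Fin g ⊕ Fin g → ℝ) ≃L[ℝ] (Fin g → ℂ)) (φ : C(ComplexTorus Φ, ComplexPoints A.X)),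
      IsAnalytification (Fin g → ℂ) A.X A.dim φ ∧ (∀ x y, φ (x + y) = φ x * φ y) ∧
      ∀ a, singularCohomology.map ℚ ℚ φ 1
          ((c a : integralLattice A.X 1) : singularCohomology ℚ ℚ (ComplexPoints A.X) 1) = latticeClass Φ a := by
  classical
  subst hg
  -- a uniformisation with some index `ι`, `|ι| = 2 dim A`
  obtain ⟨ι, _, _, Φ₀, φ₀, hφ₀, hadd₀⟩ := complexAbelianVariety_torusUniformised_holds A
  have hcard : Fintype.card ι = Fintype.card (Fin A.dim ⊕ Fin A.dim) := by
    rw [card_eq_two_mul_dim A Φ₀, Fintype.card_sum, Fintype.card_fin]; ring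
  let e : ι ≃ Fin A.dim ⊕ Fin A.dim := Fintype.equivOfCardEq hcard
  -- re-base to the frame `c` re-indexed along `e`
  let φ₀' : C(ComplexTorus Φ₀, ComplexPoints A.X) := ⟨φ₀, hφ₀.isHomeomorph.continuous⟩
  obtain ⟨P, hP, φ₁, -, hφ₁, -, hadd₁, hcls₁⟩ :=
    exists_rebase_of_basis_integralLattice_of_add A Φ₀ φ₀' hφ₀ hadd₀ (c.reindex e.symm)
  let Φ₁ : (ι → ℝ) ≃L[ℝ] (Fin A.dim → ℂ) := ComplexTorus.sublatticePeriod Φ₀ P hP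
  -- re-index the torus along `e` (permutation matrices `Pe`, `Qe`)
  let R : (Fin A.dim ⊕ Fin A.dim → ℝ) ≃L[ℝ] (ι → ℝ) := (LinearEquiv.funCongrLeft ℝ ℝ e).toContinuousLinearEquiv
  have hR : ∀ (y : Fin A.dim ⊕ Fin A.dim → ℝ) (i : ι), R y i = y (e i) := fun _ _ ↦ rfl
  let Φ : (Fin A.dim ⊕ Fin A.dim → ℝ) ≃L[ℝ] (Fin A.dim → ℂ) := R.trans Φ₁
  let Pe : Matrix (Fin A.dim ⊕ Fin A.dim) ι ℤ := fun j i ↦ if e i = j then 1 else 0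
  let Qe : Matrix ι (Fin A.dim ⊕ Fin A.dim) ℤ := fun i j ↦ if e i = j then 1 else 0
  have hPQ : Pe * Qe = 1 := by
    ext j j'
    simp only [Matrix.mul_apply, Pe, Qe, Matrix.one_apply]
    rw [Finset.sum_eq_single (e.symm j)]
    · simp only [Equiv.apply_symm_apply, if_true, one_mul]
    · intro i _ hi
      have h : e i ≠ j := fun h ↦ hi (by rw [← h, Equiv.symm_apply_apply])
      rw [if_neg h, zero_mul]
    · intro h; exact (h (Finset.mem_univ _)).elim
  have hQP : Qe * Pe = 1 := by
    ext i i'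
    simp only [Matrix.mul_apply, Pe, Qe, Matrix.one_apply]
    rw [Finset.sum_eq_single (e i)]
    · by_cases h : i = i'
      · subst h; simp
      · have h' : ¬ e i' = e i := fun h'' ↦ h (e.injective h''.symm)
        simp [h, h']
    · intro j _ hj
      rw [if_neg (Ne.symm hj), zero_mul]
    · intro h; exact (h (Finset.mem_univ _)).elim
  have hPe_mulVec : ∀ (x : ι → ℝ) (j : Fin A.dim ⊕ Fin A.dim),
      ((Pe.map (Int.cast : ℤ → ℝ)) *ᵥ x) j = x (e.symm j) := by
    intro x j
    simp only [Matrix.mulVec, dotProduct, Matrix.map_apply, Pe]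
    rw [Finset.sum_eq_single (e.symm j)]
    · simp
    · intro i _ hi
      have h : e i ≠ j := fun h ↦ hi (by rw [← h, Equiv.symm_apply_apply])
      simp [h]
    · intro h; exact (h (Finset.mem_univ _)).elim
  have hΦ' : ∀ x : ι → ℝ, Φ ((Pe.map (Int.cast : ℤ → ℝ)) *ᵥ x) = (ContinuousLinearEquiv.refl ℝ (Fin A.dim → ℂ)) (Φ₁ x) := by
    intro x
    change Φ₁ (R ((Pe.map (Int.cast : ℤ → ℝ)) *ᵥ x)) = Φ₁ x
    congr 1
    funext i
    rw [hR, hPe_mulVec, Equiv.symm_apply_apply]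
  obtain ⟨eh, heh, hehsymm, hehadd, -, hehsymm_hol⟩ :=
    ComplexTorus.exists_homeomorph_of_baseChange Φ₁ Φ Pe Qe hPQ hQP (ContinuousLinearEquiv.refl ℝ (Fin A.dim → ℂ))
      (fun _ ↦ rfl) hΦ'
  -- the re-indexed uniformisation `φ := φ₁ ∘ eh⁻¹`
  let φ : C(ComplexTorus Φ, ComplexPoints A.X) := ⟨φ₁ ∘ eh.symm, φ₁.continuous.comp eh.symm.continuous⟩
  have hehsymm_add : ∀ x y, eh.symm (x + y) = eh.symm x + eh.symm y := fun x y ↦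
    eh.injective (by rw [hehadd, eh.apply_symm_apply, eh.apply_symm_apply, eh.apply_symm_apply])
  refine ⟨Φ, φ, ?_, fun x y ↦ ?_, fun a ↦ ?_⟩
  · -- analytification: `eh⁻¹` is a biholomorphic isomorphism of tori with the same model
    exact hφ₁.comp_of_isHomeomorph eh.symm.isHomeomorph (hehsymm_hol.mdifferentiable (by simp)) rfl
  · change φ₁ (eh.symm (x + y)) = φ₁ (eh.symm x) * φ₁ (eh.symm y)
    rw [hehsymm_add, hadd₁]
  · -- lattice classes: `φ^* (c a) = (eh⁻¹)^* (φ₁^* (c a)) = (eh⁻¹)^* ξ_{e⁻¹ a} = ξ_a`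
    have hc : (c a : integralLattice A.X 1) = (c.reindex e.symm) (e.symm a) := by
      rw [Module.Basis.reindex_apply, Equiv.symm_symm, Equiv.apply_symm_apply]
    have hcomp : φ = φ₁.comp ⟨eh.symm, eh.symm.continuous⟩ := rfl
    rw [hcomp, ← singularCohomology.map_map, hc, hcls₁,
      map_latticeClass_of_mapMatrix Φ Φ₁ Qe ⟨eh.symm, eh.symm.continuous⟩ (fun t ↦ hehsymm t) (e.symm a)]
    rw [Finset.sum_eq_single a]
    · simp [Qe]
    · intro j _ hj
      simp [Qe, (Ne.symm hj : a ≠ j)]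
    · intro h; exact (h (Finset.mem_univ _)).elim

end AbelianVariety

end Literature.AlgebraicGeometry.HodgeTheory

end
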